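import Summits.ResolutionOfSingularities.ResolutionOfSingularities.Theorems.EquisingularLiftEquisingularLiftNatSectionsGlueAffineCharts
import Literature.AlgebraicGeometry.Morphisms.CechModule
import HarnessLib

/-!
# [OURS · L1 W4.5(b) · EL♮(3) · J1c B6, F6-core] Chartwise differences glue to a Čech 1-cocycle; if `Ȟ¹ = 0` they come from a cochain
Crux chain w45b, child EL♮(3) = stmt-ResolutionOfSingularities-20148; J1c = the tree-proof programme for the NEED-FACT
`EmbeddedInfinitesimalLiftFact`; this is the F5-independent Čech bookkeeping of res-type-027 g17's brick F6 `…NatChartLiftPatching`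
(split STATUS l.78813; CHAIN v7.49 §7 (e)/(f)), offered by signature by res-L1-w45b-lead-1 g12 (STATUS 2026-08-28T06:21:32Z), on top of
F2 (`…NatSectionsGlueAffineCharts`, p607569) and the tree's `Morphisms/CechModule`.

Setting: `f : Y ⟶ Spec A` (the `A`-structure of the Čech modules `MSections f M`), `g : Y ⟶ X`, `M : Y.Modules`, a predicate `Q` of «charts»
on the opens of `X` that is DOWNWARD CLOSED among affine sub-opens (F6: «the special-fibre trace lies in an lci chart»), a family
`𝒰 : I → X.Opens` each of whose members is covered by affine `Q`-charts, and CHARTWISE DIFFERENCES `d a b U ∈ Γ(M, g⁻¹U)` for the affine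
`Q`-charts `U ≤ 𝒰 a ⊓ 𝒰 b` (F6: the difference section of the two chart lifts restricted to `U`), compatible along chart inclusions and
chartwise additive `d a b U + d b c U = d a c U`.

* `exists_affine_chart_le_of_mem`, `charts_basis_below` — the affine `Q`-charts form a basis below every `𝒰 a`;
* **`exists_cechMZ1_of_chart_differences`** — there is a Čech 1-COCYCLE `μ` of `M` on the family `(g⁻¹𝒰 a)_a` whose restriction to every
  chart `g⁻¹U`, `U ≤ 𝒰 a ⊓ 𝒰 b`, is `d a b U` (glue each `μ a b` by F2 over `g⁻¹(𝒰 a ⊓ 𝒰 b)`; the cocycle identity holds chartwise by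
  additivity, hence globally by F2's uniqueness over `g⁻¹(𝒰 a ⊓ 𝒰 b ⊓ 𝒰 c)` — no intersection is assumed affine);
* **`exists_cochain_of_chart_differences`** — if moreover every 1-cocycle on `(g⁻¹𝒰 a)_a` is a coboundary (`cechMZ1 ≤ cechMB1`; F6 gets it
  from J1's two-piece `Subsingleton (CechMH1 …)` by the tree's `cechMZ1_le_cechMB1_of_refine`), then there are `ν a ∈ Γ(M, g⁻¹𝒰 a)` with
  `d a b U = ν b|_{g⁻¹U} − ν a|_{g⁻¹U}` on every chart — the correction cochain of F6.

Everything is proved; DEF-FREE; no `sorry`; standard axioms. OURS; NOT a statement of any manuscript; AI-written, weaker than expert review.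
`--supports stmt-ResolutionOfSingularities-20148 --as helper`. [cite: Hartshorne1977, III §4 (Čech cohomology) and II Ex. 1.22] (index only).
-/

set_option linter.dupNamespace false -- mandated namespace `Summit.<Summit>.<Problem>` of this single-conjunct summit
-- `TopCat.Presheaf`/`Scheme.Modules` are not reducible (as in Mathlib's `AlgebraicGeometry/Modules` and the tree's `PullbackAffineChart`).
set_option backward.isDefEq.respectTransparency false

noncomputable section

open CategoryTheory AlgebraicGeometry TopologicalSpace Opposite
open Literature.AlgebraicGeometry.Morphisms

namespace Summit.ResolutionOfSingularities.ResolutionOfSingularities.Cruxes.EquisingularLiftNat.Sections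

universe u

variable {A : Type u} [CommRing A] {X Y : Scheme.{u}} (f : Y ⟶ Spec (.of A)) (g : Y ⟶ X) (M : Y.Modules)

/-! ### Charts below a member of the family -/

/-- Shrinking a `Q`-open through `x` to an affine `Q`-chart inside any open `V ∋ x` (affine opens form a basis; `Q` is downward closed
among affine sub-opens). [folklore] -/
theorem exists_affine_chart_le_of_mem (Q : X.Opens → Prop)
    (hQ : ∀ (U U' : X.Opens), Q U → U' ≤ U → IsAffineOpen U' → Q U') {x : X} {U₀ V : X.Opens}
    (hQU₀ : Q U₀) (hx₀ : x ∈ U₀) (hxV : x ∈ V) :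
    ∃ U : X.Opens, (IsAffineOpen U ∧ Q U) ∧ x ∈ U ∧ U ≤ V := by
  obtain ⟨_, ⟨U', hU', rfl⟩, hxU', hU'le⟩ :=
    X.isBasis_affineOpens.exists_subset_of_mem_open (show x ∈ (U₀ ⊓ V : X.Opens) from ⟨hx₀, hxV⟩) (U₀ ⊓ V).isOpen
  exact ⟨U', ⟨hU', hQ U₀ U' hQU₀ (fun y hy => (hU'le hy).1) hU'⟩, hxU', fun y hy => (hU'le hy).2⟩

/-- The affine `Q`-charts form a basis of the opens below `𝒰 a`, as soon as they cover `𝒰 a`. [folklore] -/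
theorem charts_basis_below (Q : X.Opens → Prop)
    (hQ : ∀ (U U' : X.Opens), Q U → U' ≤ U → IsAffineOpen U' → Q U') {I : Type*} (𝒰 : I → X.Opens)
    (hcov : ∀ a, ∀ x ∈ 𝒰 a, ∃ U : X.Opens, IsAffineOpen U ∧ Q U ∧ x ∈ U ∧ U ≤ 𝒰 a) (a : I) :
    ∀ (V : X.Opens), V ≤ 𝒰 a → ∀ x ∈ V, ∃ U, (IsAffineOpen U ∧ Q U) ∧ x ∈ U ∧ U ≤ V := by
  intro V hV x hx
  obtain ⟨U₀, -, hQU₀, hx₀, -⟩ := hcov a x (hV hx)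
  exact exists_affine_chart_le_of_mem Q hQ hQU₀ hx₀ hx

/-! ### Chartwise differences glue to a 1-cocycle -/

section Cocycle

variable (Q : X.Opens → Prop) (hQ : ∀ (U U' : X.Opens), Q U → U' ≤ U → IsAffineOpen U' → Q U')
  {I : Type u} (𝒰 : I → X.Opens)
  (hcov : ∀ a, ∀ x ∈ 𝒰 a, ∃ U : X.Opens, IsAffineOpen U ∧ Q U ∧ x ∈ U ∧ U ≤ 𝒰 a)
  (d : ∀ (a b : I) (U : X.Opens), IsAffineOpen U → Q U → U ≤ 𝒰 a ⊓ 𝒰 b → Γ(M, g ⁻¹ᵁ U))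
  (hd : ∀ (a b : I) (U U' : X.Opens) (hU : IsAffineOpen U) (hQU : Q U) (hU' : IsAffineOpen U') (hQU' : Q U')
    (hle : U ≤ 𝒰 a ⊓ 𝒰 b) (hle' : U' ≤ 𝒰 a ⊓ 𝒰 b) (k : U' ≤ U),
    M.presheaf.map (homOfLE (g.preimage_mono k)).op (d a b U hU hQU hle) = d a b U' hU' hQU' hle')
  (hadd : ∀ (a b c : I) (U : X.Opens) (hU : IsAffineOpen U) (hQU : Q U)
    (hab : U ≤ 𝒰 a ⊓ 𝒰 b) (hbc : U ≤ 𝒰 b ⊓ 𝒰 c) (hac : U ≤ 𝒰 a ⊓ 𝒰 c),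
    d a b U hU hQU hab + d b c U hU hQU hbc = d a c U hU hQU hac)

/-- The inclusion `g⁻¹U ≤ g⁻¹𝒰 a ⊓ g⁻¹𝒰 b` for a chart `U ≤ 𝒰 a ⊓ 𝒰 b`. [folklore] -/
theorem preimage_le_inf_preimage {a b : I} {U : X.Opens} (hle : U ≤ 𝒰 a ⊓ 𝒰 b) :
    g ⁻¹ᵁ U ≤ g ⁻¹ᵁ 𝒰 a ⊓ g ⁻¹ᵁ 𝒰 b :=
  le_inf (g.preimage_mono (hle.trans inf_le_left)) (g.preimage_mono (hle.trans inf_le_right))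

/-- `g⁻¹𝒰 a ⊓ g⁻¹𝒰 b ≤ g⁻¹(𝒰 a ⊓ 𝒰 b)` (an equality; the inequality is what the Čech cochains need). [folklore] -/
theorem inf_preimage_le_preimage_inf (a b : I) : g ⁻¹ᵁ 𝒰 a ⊓ g ⁻¹ᵁ 𝒰 b ≤ g ⁻¹ᵁ (𝒰 a ⊓ 𝒰 b) :=
  fun _ hy => hy

include hQ hcov hd hadd in
/-- **Chartwise differences glue to a Čech 1-cocycle**: there is `μ ∈ Ž¹((g⁻¹𝒰 a)_a, M)` whose restriction to `g⁻¹U` is `d a b U` for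
every affine `Q`-chart `U ≤ 𝒰 a ⊓ 𝒰 b`. [folklore] -/
theorem exists_cechMZ1_of_chart_differences :
    ∃ μ : CechMC1 f M (fun a => g ⁻¹ᵁ 𝒰 a), μ ∈ cechMZ1 f M (fun a => g ⁻¹ᵁ 𝒰 a) ∧
      ∀ (a b : I) (U : X.Opens) (hU : IsAffineOpen U) (hQU : Q U) (hle : U ≤ 𝒰 a ⊓ 𝒰 b),
        MSections.res f M (preimage_le_inf_preimage g 𝒰 hle) (μ a b) = d a b U hU hQU hle := by
  -- glue each `t a b` over `g⁻¹(𝒰 a ⊓ 𝒰 b)` (F2), then restrict it to the Čech open `g⁻¹𝒰 a ⊓ g⁻¹𝒰 b`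
  have hglue : ∀ a b : I, ∃! t : Γ(M, g ⁻¹ᵁ (𝒰 a ⊓ 𝒰 b)), ∀ (U : X.Opens) (hU : IsAffineOpen U) (hQU : Q U)
      (hUΩ : U ≤ 𝒰 a ⊓ 𝒰 b), M.presheaf.map (homOfLE (g.preimage_mono hUΩ)).op t = d a b U hU hQU hUΩ := fun a b =>
    existsUnique_section_of_affine_chart_family g M Q hQ (𝒰 a ⊓ 𝒰 b)
      (fun x hx => by
        obtain ⟨U, ⟨hU, hQU⟩, hxU, hUle⟩ := charts_basis_below Q hQ 𝒰 hcov a (𝒰 a ⊓ 𝒰 b) inf_le_left x hx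
        exact ⟨U, hU, hQU, hxU, hUle⟩)
      (fun U hU hQU hUΩ => d a b U hU hQU hUΩ) (fun U U' hU hQU hU' hQU' hUΩ hU'Ω k => hd a b U U' hU hQU hU' hQU' hUΩ hU'Ω k)
  choose t ht _ using hglue
  -- the values of `t` on the charts, in `MSections.res` form (any proof of the inclusion)
  have ht' : ∀ (a b : I) (U : X.Opens) (hU : IsAffineOpen U) (hQU : Q U) (hUΩ : U ≤ 𝒰 a ⊓ 𝒰 b)
      (h : g ⁻¹ᵁ U ≤ g ⁻¹ᵁ (𝒰 a ⊓ 𝒰 b)), MSections.res f M h (t a b : MSections f M (g ⁻¹ᵁ (𝒰 a ⊓ 𝒰 b))) = d a b U hU hQU hUΩ :=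
    fun a b U hU hQU hUΩ h => ht a b U hU hQU hUΩ
  refine ⟨fun a b => MSections.res f M (inf_preimage_le_preimage_inf g 𝒰 a b) (t a b), ?_, fun a b U hU hQU hle => ?_⟩
  · -- the cocycle identity, checked on the charts below `𝒰 a ⊓ 𝒰 b ⊓ 𝒰 c`
    rw [mem_cechMZ1_iff]
    funext a b c
    rw [cechMD1_apply, Pi.zero_apply, Pi.zero_apply, Pi.zero_apply, MSections.res_res, MSections.res_res, MSections.res_res]
    have hΩ : 𝒰 a ⊓ 𝒰 b ⊓ 𝒰 c ≤ 𝒰 a := inf_le_left.trans inf_le_left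
    -- transport to the open `g⁻¹(𝒰 a ⊓ 𝒰 b ⊓ 𝒰 c)`, where F2's uniqueness applies
    have h₁ : g ⁻¹ᵁ (𝒰 a ⊓ 𝒰 b ⊓ 𝒰 c) ≤ g ⁻¹ᵁ 𝒰 a ⊓ g ⁻¹ᵁ 𝒰 b ⊓ g ⁻¹ᵁ 𝒰 c := fun _ hy => hy
    have h₂ : g ⁻¹ᵁ 𝒰 a ⊓ g ⁻¹ᵁ 𝒰 b ⊓ g ⁻¹ᵁ 𝒰 c ≤ g ⁻¹ᵁ (𝒰 a ⊓ 𝒰 b ⊓ 𝒰 c) := fun _ hy => hy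
    suffices hE : MSections.res f M h₁
        (MSections.res f M ((le_inf (inf_le_left.trans inf_le_right) inf_le_right).trans (inf_preimage_le_preimage_inf g 𝒰 b c)) (t b c) -
          MSections.res f M ((le_inf (inf_le_left.trans inf_le_left) inf_le_right).trans (inf_preimage_le_preimage_inf g 𝒰 a c)) (t a c) +
          MSections.res f M (inf_le_left.trans (inf_preimage_le_preimage_inf g 𝒰 a b)) (t a b)) = 0 by
      have h := congrArg (MSections.res f M h₂) hE
      rwa [MSections.res_res, map_zero, MSections.res_self] at h
    refine section_eq_of_forall_map_chart_eq g M (fun U => IsAffineOpen U ∧ Q U) (𝒰 a ⊓ 𝒰 b ⊓ 𝒰 c)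
      (fun V hV => charts_basis_below Q hQ 𝒰 hcov a V (hV.trans hΩ)) _ _ fun U hU hUΩ => ?_
    have hab : U ≤ 𝒰 a ⊓ 𝒰 b := hUΩ.trans inf_le_left
    have hbc : U ≤ 𝒰 b ⊓ 𝒰 c := le_inf (hUΩ.trans (inf_le_left.trans inf_le_right)) (hUΩ.trans inf_le_right)
    have hac : U ≤ 𝒰 a ⊓ 𝒰 c := le_inf (hUΩ.trans hΩ) (hUΩ.trans inf_le_right)
    show MSections.res f M (g.preimage_mono hUΩ) _ = MSections.res f M (g.preimage_mono hUΩ) 0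
    rw [map_zero, MSections.res_res, map_add, map_sub, MSections.res_res, MSections.res_res, MSections.res_res,
      ht' b c U hU.1 hU.2 hbc, ht' a c U hU.1 hU.2 hac, ht' a b U hU.1 hU.2 hab, ← hadd a b c U hU.1 hU.2 hab hbc hac]
    abel
  · rw [MSections.res_res]
    exact ht' a b U hU hQU hle _

include hQ hcov hd hadd in
/-- **If `Ȟ¹ = 0` on the family, the chartwise differences come from a cochain**: if every 1-cocycle of `M` on `(g⁻¹𝒰 a)_a` is a
coboundary, there are sections `ν a ∈ Γ(M, g⁻¹𝒰 a)` with `ν b|_{g⁻¹U} − ν a|_{g⁻¹U} = d a b U` on every affine `Q`-chart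
`U ≤ 𝒰 a ⊓ 𝒰 b` — the correction cochain of the patching step. [folklore] -/
theorem exists_cochain_of_chart_differences
    (hH1 : cechMZ1 f M (fun a => g ⁻¹ᵁ 𝒰 a) ≤ cechMB1 f M (fun a => g ⁻¹ᵁ 𝒰 a)) :
    ∃ ν : ∀ a : I, Γ(M, g ⁻¹ᵁ 𝒰 a), ∀ (a b : I) (U : X.Opens) (hU : IsAffineOpen U) (hQU : Q U) (hle : U ≤ 𝒰 a ⊓ 𝒰 b),
      MSections.res f M (g.preimage_mono (hle.trans inf_le_right)) (ν b : MSections f M (g ⁻¹ᵁ 𝒰 b)) -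
          MSections.res f M (g.preimage_mono (hle.trans inf_le_left)) (ν a : MSections f M (g ⁻¹ᵁ 𝒰 a)) =
        d a b U hU hQU hle := by
  obtain ⟨μ, hμZ, hμ⟩ := exists_cechMZ1_of_chart_differences f g M Q hQ 𝒰 hcov d hd hadd
  obtain ⟨ν, hν⟩ := (mem_cechMB1_iff f M _ μ).mp (hH1 hμZ)
  refine ⟨ν, fun a b U hU hQU hle => ?_⟩
  rw [← hμ a b U hU hQU hle, ← hν, cechMD0_apply, map_sub, MSections.res_res, MSections.res_res]

end Cocycle

end Summit.ResolutionOfSingularities.ResolutionOfSingularities.Cruxes.EquisingularLiftNat.Sections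

end
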